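import Summits.RiemannHypothesis.RiemannHypothesis.Theorems.HandoffDodgerAsymptoticsF
import HarnessLib

/-!
# HANDOFF — SMALL THRESHOLD (4): cost, gain and the comparison `hlt` of `dodger_witness_explicit` at `y = 2L^{3/2}` for every `b ≥ 11/2` (rh-explicit, D-0040 WEIL column prover seat handoff-prove-2 gen11, ATTEMPT-21 §5)

HONEST FRAMING. Nothing here bears on the truth of RH; elementary real inequalities (Mathlib + gen10's `count_factor_le_one`,
`exp_numerics`). gen10's part (F) (`cost_le`, `gain_ge`, `exp_dominates`, `cost_lt_gain`) proves the ONE comparison hypothesis `hlt`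
of `HandoffDodgerExplicit.dodger_witness_explicit` for `b ≥ 100`; here, in the same abstract variables and with the horizon facts
of `HandoffDodgerSmallHorizon` (`17e^{2b} ≤ T`, hence `22100(b+1)² ≤ T`), we prove for EVERY `b ≥ 11/2`:
* `cost_prefactor_le_small`: `4(sinh²(δ/2)+1)e·4cosh²(b/2)(1+b)²/b² ≤ 15.5·e^b` for `0 ≤ δ ≤ 10⁻³` (the exact `4cosh²(b/2) = e^b + 2 + e^{−b}`
  replaces gen10's `cosh² ≤ e^b`, which loses a factor `4`);
* `cost_first_le_small` (`≤ 1/(T√T)`), `cost_second_le_small` (`≤ 5220(b+1.84)/(T√T)`), `cost_le_small` (`≤ 2310(b+1.84)/e^{2b}`);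
* `gain_ge_small`: `(3/200)·Φ₀²/e^{4b} ≤ gain` for any `0 ≤ Φ₀ ≤ Φ` (`κ ≥ 1/2`, `600r ≤ δL`, `Q ≤ 1.011e^b`);
* `cost_lt_gain_small`: the comparison, GIVEN the profile-value inequality `154000(b+1.84)e^{2b} < Φ₀²` (discharged for
  `Φ = dodgerPhi(9y²/64)` in `HandoffDodgerSmallPhi`).
No `sorry`, standard axioms.

References: this track (ATTEMPT-16 §4–§6; ATTEMPT-19 §8 (P7); ATTEMPT-21 §5).
-/

set_option linter.dupNamespace false

noncomputable section

open Real

namespace Summit.RiemannHypothesis.RiemannHypothesis.Theorems.Handoff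

/-- **The cost prefactor, sharp in `cosh`.** `0 ≤ δ ≤ 10⁻³`, `b ≥ 11/2` ⟹
`4(sinh²(δ/2)+1)·e·(4cosh²(b/2)(1+b)²/b²) ≤ 15.5·e^b`. [this track, ATTEMPT-21 §5] -/
theorem cost_prefactor_le_small {δ b : ℝ} (hδ0 : 0 ≤ δ) (hδ1 : δ ≤ 1 / 1000) (hb : 11 / 2 ≤ b) :
    4 * (Real.sinh (δ / 2) ^ 2 + 1) * Real.exp 1 * (4 * Real.cosh (b / 2) ^ 2 * (1 + b) ^ 2 / b ^ 2) ≤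
      15.5 * Real.exp b := by
  have hb0 : 0 < b := by linarith
  have cosh_le : ∀ x : ℝ, 0 ≤ x → Real.cosh x ≤ Real.exp x := fun x hx => by
    rw [Real.cosh_eq]
    have : Real.exp (-x) ≤ Real.exp x := Real.exp_le_exp.2 (by linarith)
    linarith
  -- `sinh²(δ/2)+1 = cosh²(δ/2) ≤ e^δ ≤ 1.002`
  have h1 : Real.sinh (δ / 2) ^ 2 + 1 ≤ 1.002 := by
    rw [← Real.cosh_sq]
    have hc := cosh_le (δ / 2) (by linarith)
    have hc0 : 0 ≤ Real.cosh (δ / 2) := (Real.cosh_pos _).le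
    have hexpδ : Real.exp δ ≤ 1 + 2 * δ := by
      have := Real.abs_exp_sub_one_le (x := δ) (by rw [abs_of_nonneg hδ0]; linarith)
      rw [abs_of_nonneg hδ0] at this
      have := (abs_le.1 this).2
      linarith
    calc Real.cosh (δ / 2) ^ 2 ≤ Real.exp (δ / 2) ^ 2 := pow_le_pow_left₀ hc0 hc 2
      _ = Real.exp δ := by rw [← Real.exp_nat_mul]; ring_nf
      _ ≤ 1.002 := by linarith
  -- `4cosh²(b/2) = e^b + 2 + e^{-b} ≤ 1.0123 e^b` since `e^b ≥ 244`
  set Eb := Real.exp b with hEb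
  have hEb0 : 0 < Eb := Real.exp_pos b
  have hE2 : Real.exp (2 * b) = Eb ^ 2 := by rw [hEb, ← Real.exp_nat_mul]; ring_nf
  have hEb244 : 244 ≤ Eb := by
    have h11 : Real.exp 11 = Real.exp 1 ^ 11 := by exact_mod_cast (Real.exp_one_pow 11).symm
    have he11 : (59870 : ℝ) ≤ Real.exp 11 := by
      rw [h11]; exact le_trans (by norm_num) (pow_le_pow_left₀ (by norm_num) Real.exp_one_gt_d9.le 11)
    have h2b : Real.exp 11 ≤ Real.exp (2 * b) := Real.exp_le_exp.2 (by linarith)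
    rw [hE2] at h2b
    nlinarith only [he11, h2b, hEb0]
  have h2 : 4 * Real.cosh (b / 2) ^ 2 ≤ 1.0123 * Eb := by
    have hhalf : Real.exp (b / 2) ^ 2 = Eb := by rw [hEb, ← Real.exp_nat_mul]; ring_nf
    have hneg : Real.exp (-(b / 2)) * Real.exp (b / 2) = 1 := by rw [← Real.exp_add]; norm_num
    have e4 : 4 * Real.cosh (b / 2) ^ 2 = Eb + 2 + Real.exp (-(b / 2)) ^ 2 := by
      rw [Real.cosh_eq]; nlinarith only [hhalf, hneg]
    have hinv : Real.exp (-(b / 2)) ^ 2 ≤ 1 := by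
      have : Real.exp (-(b / 2)) ≤ 1 := by rw [Real.exp_le_one_iff]; linarith
      have h0 := (Real.exp_pos (-(b / 2))).le
      nlinarith only [this, h0]
    rw [e4]; nlinarith only [hinv, hEb244]
  have h3 : (1 + b) ^ 2 / b ^ 2 ≤ 1.4 := by
    rw [div_le_iff₀ (by positivity)]; nlinarith only [hb]
  have he := Real.exp_one_lt_d9
  have h4 : 4 * Real.cosh (b / 2) ^ 2 * (1 + b) ^ 2 / b ^ 2 ≤ 1.0123 * Eb * 1.4 := by
    rw [mul_div_assoc]
    exact mul_le_mul h2 h3 (by positivity) (by positivity)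
  calc 4 * (Real.sinh (δ / 2) ^ 2 + 1) * Real.exp 1 * (4 * Real.cosh (b / 2) ^ 2 * (1 + b) ^ 2 / b ^ 2)
      ≤ 4 * 1.002 * 2.7182818286 * (1.0123 * Eb * 1.4) := by
        have a : 4 * (Real.sinh (δ / 2) ^ 2 + 1) * Real.exp 1 ≤ 4 * 1.002 * 2.7182818286 := by
          have := Real.exp_pos 1
          nlinarith only [h1, he, this, Real.cosh_sq (δ / 2), sq_nonneg (Real.sinh (δ / 2))]
        exact mul_le_mul a h4 (by positivity) (by positivity)
    _ ≤ 15.5 * Eb := by nlinarith only [hEb0]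

/-- `log T ≤ 2b + 3` when `0 < T ≤ 2πe^{1+2b}` (`log 2π ≤ 2`). [this track, ATTEMPT-21 §5] -/
theorem log_horizon_le_small {T b : ℝ} (hT0 : 0 < T) (hT : T ≤ 2 * π * Real.exp (1 + 2 * b)) :
    Real.log T ≤ 2 * b + 3 := by
  have hπ3 : 3 < π := Real.pi_gt_three
  have h1 : Real.log T ≤ Real.log (2 * π * Real.exp (1 + 2 * b)) := Real.log_le_log hT0 hT
  rw [Real.log_mul (by positivity) (Real.exp_pos _).ne', Real.log_exp] at h1
  have hl2π2 : Real.log (2 * π) ≤ 2 := by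
    have h72 := exp_numerics.2.1
    have : 2 * π ≤ Real.exp 2 := by have := Real.pi_lt_d2; linarith
    calc Real.log (2 * π) ≤ Real.log (Real.exp 2) := Real.log_le_log (by positivity) this
      _ = 2 := Real.log_exp 2
  linarith

set_option maxHeartbeats 400000 in
/-- **The first cost term** `≤ 1/(T√T)`, for `b ≥ 11/2` and `22100(b+1)² ≤ T`. [this track, ATTEMPT-21 §5] -/
theorem cost_first_le_small {T b k cI cL : ℝ} (hb : 11 / 2 ≤ b) (hT : 22100 * (b + 1) ^ 2 ≤ T)
    (hTT₀ : T ≤ 2 * π * Real.exp (1 + 2 * b)) (hk2 : 2 ≤ k) (hk : k ≤ 2 / 5 * b * T)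
    (hcI : T ^ 3 / (19 * π) ≤ cI) (hcL : cL = 4 * cI) :
    ((2 * T) / (2 * π) * Real.log ((2 * T) / (2 * π * Real.exp 1)) +
          (0.1038 * Real.log (2 * T) + 0.2573 * Real.log (Real.log (2 * T)) + 9.3675)) / T ^ 2 *
        Real.exp (4 * (b / π * (1 + Real.log (k - 1))) - cL / (2 * T + 1) ^ 2) ≤ 1 / (T * Real.sqrt T) := by
  have hπ3 : 3 < π := Real.pi_gt_three
  have hπ4 : π < 3.1416 := Real.pi_lt_d4
  have hb0 : 0 < b := by linarith
  have hT0 : 0 < T := by nlinarith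
  have hT1 : 40000 ≤ T := by nlinarith
  have hN := count_factor_le_one (by linarith : 100 ≤ T)
  refine (mul_le_of_le_one_left (Real.exp_pos _).le hN).trans ?_
  have hlogk : Real.log (k - 1) ≤ 3 * b + 2 := by
    have h1 : Real.log (k - 1) ≤ Real.log k := Real.log_le_log (by linarith) (by linarith)
    have h2 : Real.log k ≤ Real.log (b * T) := Real.log_le_log (by linarith) (by nlinarith)
    rw [Real.log_mul hb0.ne' hT0.ne'] at h2
    have h3 : Real.log b ≤ b - 1 := Real.log_le_sub_one_of_pos hb0
    have h4 := log_horizon_le_small hT0 hTT₀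
    linarith
  have hA : 4 * (b / π * (1 + Real.log (k - 1))) ≤ 6 * b ^ 2 := by
    have h1 : b / π ≤ b / 3 := div_le_div_of_nonneg_left hb0.le (by norm_num) hπ3.le
    have h2 : 0 ≤ 1 + Real.log (k - 1) := by
      have : 0 ≤ Real.log (k - 1) := Real.log_nonneg (by linarith)
      linarith
    have h3 : b / π * (1 + Real.log (k - 1)) ≤ b / 3 * (3 * b + 3) :=
      mul_le_mul h1 (by linarith) h2 (by positivity)
    nlinarith
  have hB : T / 60.5 ≤ cL / (2 * T + 1) ^ 2 := by
    rw [hcL, div_le_div_iff₀ (by norm_num) (by positivity)]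
    have h1 : (2 * T + 1) ^ 2 ≤ 4.04 * T ^ 2 := by nlinarith
    have h2 : T ^ 3 / (19 * π) ≥ T ^ 3 / 59.7 := div_le_div_of_nonneg_left (by positivity) (by positivity) (by nlinarith)
    have h3 : T * (2 * T + 1) ^ 2 ≤ T * (4.04 * T ^ 2) := mul_le_mul_of_nonneg_left h1 hT0.le
    have h4 : T ^ 3 ≤ 59.7 * cI := by
      have := h2.le.trans hcI; rw [div_le_iff₀ (by norm_num)] at this; linarith
    nlinarith
  have hE : 4 * (b / π * (1 + Real.log (k - 1))) - cL / (2 * T + 1) ^ 2 ≤ -(T / 100) := by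
    have : 6 * b ^ 2 ≤ T / 60.5 - T / 100 := by
      rw [div_sub_div _ _ (by norm_num) (by norm_num), le_div_iff₀ (by norm_num)]; nlinarith
    linarith
  refine (Real.exp_le_exp.2 hE).trans ?_
  rw [Real.exp_neg, one_div, inv_le_inv₀ (Real.exp_pos _) (by positivity)]
  have h3 : (T / 100) ^ 3 / 6 ≤ Real.exp (T / 100) := by
    have := Real.pow_div_factorial_le_exp (T / 100) (by positivity) 3
    norm_num [Nat.factorial] at this; exact this
  have hs : Real.sqrt T ≤ T / 200 := by
    rw [Real.sqrt_le_left (by positivity)]; nlinarith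
  have h4 : T * Real.sqrt T ≤ T * (T / 200) := mul_le_mul_of_nonneg_left hs hT0.le
  nlinarith [pow_pos hT0 3]

set_option maxHeartbeats 400000 in
/-- **The second cost term** `≤ 5220(b+1.84)/(T√T)`, for `22100(b+1)² ≤ T`. [this track, ATTEMPT-21 §5] -/
theorem cost_second_le_small {T b k cI cL xL : ℝ} (hb : 11 / 2 ≤ b) (hT : 22100 * (b + 1) ^ 2 ≤ T)
    (hTT₀ : T ≤ 2 * π * Real.exp (1 + 2 * b)) (hk2 : 2 ≤ k) (hk : k ≤ 2 / 5 * b * T)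
    (hcI : T ^ 3 / (19 * π) ≤ cI) (hcI2 : cI ≤ T ^ 3) (hcL : cL = 4 * cI) (hxL : xL = Real.sqrt (cL / 4)) :
    Real.exp (144 * (2 * k) ^ 2 / (7 * cL)) * (Real.log xL / (Real.exp 1 * xL) + 220 * (Real.log xL + 1) / xL) ≤
      5220 * (b + 1.84) / (T * Real.sqrt T) := by
  have hπ3 : 3 < π := Real.pi_gt_three
  have hπ4 : π < 3.1416 := Real.pi_lt_d4
  have hb0 : 0 < b := by linarith
  have hT0 : 0 < T := by nlinarith
  have hx : xL = Real.sqrt cI := by rw [hxL, hcL]; ring_nf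
  have hcI0 : T ^ 3 / 59.7 ≤ cI := le_trans (div_le_div_of_nonneg_left (by positivity) (by positivity) (by nlinarith)) hcI
  have hcIpos : 0 < cI := lt_of_lt_of_le (by positivity) hcI0
  have hTs : 0 < T * Real.sqrt T := by positivity
  have hx1 : T * Real.sqrt T / 7.73 ≤ xL := by
    rw [hx, Real.le_sqrt (by positivity) hcIpos.le, div_pow, mul_pow, Real.sq_sqrt hT0.le]
    rw [div_le_iff₀ (by norm_num)]; rw [div_le_iff₀ (by norm_num)] at hcI0; nlinarith
  have hx2 : 1 ≤ xL := by
    have : 7.73 ≤ T * Real.sqrt T := by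
      have hs : 1 ≤ Real.sqrt T := by rw [Real.le_sqrt (by norm_num) hT0.le]; nlinarith
      nlinarith
    have : 1 ≤ T * Real.sqrt T / 7.73 := by rw [le_div_iff₀ (by norm_num)]; linarith
    linarith
  have hx0 : 0 < xL := by linarith
  have hlx0 : 0 ≤ Real.log xL := Real.log_nonneg hx2
  have hlx : Real.log xL ≤ 3 * b + 4.5 := by
    rw [hx, Real.log_sqrt hcIpos.le]
    have h1 : Real.log cI ≤ Real.log (T ^ 3) := Real.log_le_log hcIpos hcI2
    rw [Real.log_pow] at h1
    have h2 := log_horizon_le_small hT0 hTT₀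
    push_cast at h1
    linarith
  have hexp : Real.exp (144 * (2 * k) ^ 2 / (7 * cL)) ≤ 1.02 := by
    have hu0 : 0 ≤ 144 * (2 * k) ^ 2 / (7 * cL) := by rw [hcL]; positivity
    have hu : 144 * (2 * k) ^ 2 / (7 * cL) ≤ 1 / 100 := by
      rw [hcL, div_le_div_iff₀ (by positivity) (by norm_num)]
      have h1 : (2 * k) ^ 2 ≤ (2 * (2 / 5 * b * T)) ^ 2 := pow_le_pow_left₀ (by linarith) (by linarith) 2
      have h2 : 20000 * b ^ 2 ≤ T := by nlinarith
      have h3 : T ^ 3 ≤ 59.7 * cI := by rw [div_le_iff₀ (by norm_num)] at hcI0; linarith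
      nlinarith [mul_le_mul_of_nonneg_left h2 (by positivity : (0:ℝ) ≤ b ^ 2 * T ^ 2), sq_nonneg b, sq_nonneg T]
    have := Real.abs_exp_sub_one_le (x := 144 * (2 * k) ^ 2 / (7 * cL)) (by rw [abs_of_nonneg hu0]; linarith)
    rw [abs_of_nonneg hu0] at this
    have := (abs_le.1 this).2
    linarith
  have he : 2.7 < Real.exp 1 := lt_trans (by norm_num) Real.exp_one_gt_d9
  have hbr : Real.log xL / (Real.exp 1 * xL) + 220 * (Real.log xL + 1) / xL ≤ 662 * (b + 1.84) / xL := by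
    have h1 : Real.log xL / (Real.exp 1 * xL) ≤ (3 * b + 4.5) / 2.7 / xL := by
      rw [div_div, div_le_div_iff₀ (by positivity) (by positivity)]
      have := mul_le_mul hlx he.le (by norm_num) (by linarith)
      nlinarith
    have h2 : 220 * (Real.log xL + 1) / xL ≤ 220 * (3 * b + 5.5) / xL :=
      div_le_div_of_nonneg_right (by linarith) hx0.le
    have h3 : (3 * b + 4.5) / 2.7 / xL + 220 * (3 * b + 5.5) / xL ≤ 662 * (b + 1.84) / xL := by
      rw [← add_div, div_le_div_iff_of_pos_right hx0]
      rw [div_add' _ _ _ (by norm_num), div_le_iff₀ (by norm_num)]; nlinarith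
    linarith
  have hbr0 : 0 ≤ Real.log xL / (Real.exp 1 * xL) + 220 * (Real.log xL + 1) / xL := by positivity
  calc Real.exp (144 * (2 * k) ^ 2 / (7 * cL)) * (Real.log xL / (Real.exp 1 * xL) + 220 * (Real.log xL + 1) / xL)
      ≤ 1.02 * (662 * (b + 1.84) / xL) := mul_le_mul hexp hbr hbr0 (by norm_num)
    _ ≤ 1.02 * (662 * (b + 1.84) / (T * Real.sqrt T / 7.73)) := by
        have := div_le_div_of_nonneg_left (by positivity : 0 ≤ 662 * (b + 1.84)) (by positivity) hx1
        nlinarith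
    _ = 1.02 * 662 * 7.73 * (b + 1.84) / (T * Real.sqrt T) := by field_simp
    _ ≤ 5220 * (b + 1.84) / (T * Real.sqrt T) := by
        apply div_le_div_of_nonneg_right _ hTs.le; nlinarith

set_option maxHeartbeats 400000 in
/-- **Total cost** `≤ 2310(b+1.84)/e^{2b}`, for `b ≥ 11/2`, `17e^{2b} ≤ T`, `0 ≤ δU ≤ 10⁻³`. [this track, ATTEMPT-21 §5] -/
theorem cost_le_small {T b k cI cL xL δU : ℝ} (hb : 11 / 2 ≤ b) (hTe : 17 * Real.exp (2 * b) ≤ T)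
    (hTT₀ : T ≤ 2 * π * Real.exp (1 + 2 * b))
    (hk2 : 2 ≤ k) (hk : k ≤ 2 / 5 * b * T)
    (hcI : T ^ 3 / (19 * π) ≤ cI) (hcI2 : cI ≤ T ^ 3) (hcL : cL = 4 * cI) (hxL : xL = Real.sqrt (cL / 4))
    (hδ0 : 0 ≤ δU) (hδ1 : δU ≤ 1 / 1000) :
    2 * (4 * (Real.sinh (δU / 2) ^ 2 + 1) * Real.exp 1 * (4 * Real.cosh (b / 2) ^ 2 * (1 + b) ^ 2 / b ^ 2)) *
        (((2 * T) / (2 * π) * Real.log ((2 * T) / (2 * π * Real.exp 1)) +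
              (0.1038 * Real.log (2 * T) + 0.2573 * Real.log (Real.log (2 * T)) + 9.3675)) / T ^ 2 *
            Real.exp (4 * (b / π * (1 + Real.log (k - 1))) - cL / (2 * T + 1) ^ 2) +
          Real.exp (144 * (2 * k) ^ 2 / (7 * cL)) * (Real.log xL / (Real.exp 1 * xL) + 220 * (Real.log xL + 1) / xL)) ≤
      2310 * (b + 1.84) / Real.exp (2 * b) := by
  have hπ3 : 3 < π := Real.pi_gt_three
  have hb0 : 0 < b := by linarith
  -- `T ≥ 22100 (b+1)²` from `e^{2b} ≥ 1300 (b+1)²`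
  set Eb := Real.exp b with hEb
  have hEb0 : 0 < Eb := Real.exp_pos b
  have hE2 : Real.exp (2 * b) = Eb ^ 2 := by rw [hEb, ← Real.exp_nat_mul]; ring_nf
  have hexp2b : 1300 * (b + 1) ^ 2 ≤ Real.exp (2 * b) := by
    -- `e^{2b} = e^{11} e^{2b-11} ≥ 59000 (1 + (2b-11) + (2b-11)²/2)`
    set t : ℝ := 2 * b - 11 with ht
    have ht0 : 0 ≤ t := by rw [ht]; linarith
    have h11 : Real.exp 11 = Real.exp 1 ^ 11 := by exact_mod_cast (Real.exp_one_pow 11).symm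
    have he11 : (59000 : ℝ) ≤ Real.exp 11 := by
      rw [h11]; exact le_trans (by norm_num) (pow_le_pow_left₀ (by norm_num) Real.exp_one_gt_d9.le 11)
    have hsplit : Real.exp (2 * b) = Real.exp 11 * Real.exp t := by rw [← Real.exp_add]; congr 1; rw [ht]; ring
    have hq : 1 + t + t ^ 2 / 2 ≤ Real.exp t := Real.quadratic_le_exp_of_nonneg ht0
    have hmain : 59000 * (1 + t + t ^ 2 / 2) ≤ Real.exp (2 * b) := by
      rw [hsplit]; exact mul_le_mul he11 hq (by positivity) (Real.exp_pos 11).le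
    have : 1300 * (b + 1) ^ 2 ≤ 59000 * (1 + t + t ^ 2 / 2) := by rw [ht]; nlinarith only [hb]
    exact this.trans hmain
  have hT : 22100 * (b + 1) ^ 2 ≤ T := by linarith only [hexp2b, hTe]
  have hT0 : 0 < T := by nlinarith
  have hP := cost_prefactor_le_small hδ0 hδ1 hb
  have hF := cost_first_le_small hb hT hTT₀ hk2 hk hcI hcL
  have hS := cost_second_le_small hb hT hTT₀ hk2 hk hcI hcI2 hcL hxL
  have hTs : 0 < T * Real.sqrt T := by positivity
  have hT16 : 17 * Eb ^ 2 ≤ T := by rw [← hE2]; exact hTe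
  have hsq : 4.123 * Eb ≤ Real.sqrt T := by
    rw [Real.le_sqrt (by positivity) hT0.le]; nlinarith only [hT16, pow_pos hEb0 2]
  have hTs2 : 70.09 * Eb * Eb ^ 2 ≤ T * Real.sqrt T := by
    have := mul_le_mul hT16 hsq (by positivity) hT0.le; nlinarith only [this, pow_pos hEb0 3]
  have hsum : ((2 * T) / (2 * π) * Real.log ((2 * T) / (2 * π * Real.exp 1)) +
              (0.1038 * Real.log (2 * T) + 0.2573 * Real.log (Real.log (2 * T)) + 9.3675)) / T ^ 2 *
            Real.exp (4 * (b / π * (1 + Real.log (k - 1))) - cL / (2 * T + 1) ^ 2) +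
          Real.exp (144 * (2 * k) ^ 2 / (7 * cL)) * (Real.log xL / (Real.exp 1 * xL) + 220 * (Real.log xL + 1) / xL) ≤
        5221 * (b + 1.84) / (70.09 * Eb * Eb ^ 2) := by
    have h1 : 1 / (T * Real.sqrt T) + 5220 * (b + 1.84) / (T * Real.sqrt T) ≤ 5221 * (b + 1.84) / (T * Real.sqrt T) := by
      rw [← add_div]; exact div_le_div_of_nonneg_right (by linarith) hTs.le
    have h2 : 5221 * (b + 1.84) / (T * Real.sqrt T) ≤ 5221 * (b + 1.84) / (70.09 * Eb * Eb ^ 2) :=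
      div_le_div_of_nonneg_left (by positivity) (by positivity) hTs2
    linarith
  have hsum0 : 0 ≤ 5221 * (b + 1.84) / (70.09 * Eb * Eb ^ 2) := by positivity
  calc 2 * (4 * (Real.sinh (δU / 2) ^ 2 + 1) * Real.exp 1 * (4 * Real.cosh (b / 2) ^ 2 * (1 + b) ^ 2 / b ^ 2)) *
        (((2 * T) / (2 * π) * Real.log ((2 * T) / (2 * π * Real.exp 1)) +
              (0.1038 * Real.log (2 * T) + 0.2573 * Real.log (Real.log (2 * T)) + 9.3675)) / T ^ 2 *
            Real.exp (4 * (b / π * (1 + Real.log (k - 1))) - cL / (2 * T + 1) ^ 2) +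
          Real.exp (144 * (2 * k) ^ 2 / (7 * cL)) * (Real.log xL / (Real.exp 1 * xL) + 220 * (Real.log xL + 1) / xL))
      ≤ 2 * (4 * (Real.sinh (δU / 2) ^ 2 + 1) * Real.exp 1 * (4 * Real.cosh (b / 2) ^ 2 * (1 + b) ^ 2 / b ^ 2)) *
        (5221 * (b + 1.84) / (70.09 * Eb * Eb ^ 2)) := mul_le_mul_of_nonneg_left hsum (by positivity)
    _ ≤ 2 * (15.5 * Eb) * (5221 * (b + 1.84) / (70.09 * Eb * Eb ^ 2)) :=
        mul_le_mul_of_nonneg_right (by linarith) hsum0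
    _ = 2 * 15.5 * 5221 / 70.09 * (b + 1.84) / Eb ^ 2 := by field_simp
    _ ≤ 2310 * (b + 1.84) / Real.exp (2 * b) := by
        rw [hE2]; apply div_le_div_of_nonneg_right _ (by positivity); nlinarith

/-- **Total gain** `≥ (3/200)·Φ₀²/e^{4b}` for any `0 ≤ Φ₀ ≤ Φ`, at `y = 2L√L`, `κ ≥ 1/2`, `600r ≤ δL`, `Q ≤ 1.011e^b`,
`T ≤ 2πe^{1+2b}`. [this track, ATTEMPT-21 §5] -/
theorem gain_ge_small {b L Q δL r κ y pU T Φ Φ₀ : ℝ} (hb : 11 / 2 ≤ b) (hL1 : 2 * b ≤ L)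
    (hQ0 : 0 < Q) (hQ : Q ≤ 1.011 * Real.exp b) (hκ : 1 / 2 ≤ κ) (hr : 600 * r ≤ δL)
    (hy : y = 2 * (L * Real.sqrt L)) (hδL : δL = y / Real.sqrt pU) (hpU0 : 0 < pU)
    (hpU : pU ≤ 41 / 100 * b * T ^ 3) (hT0 : 0 < T) (hTT₀ : T ≤ 2 * π * Real.exp (1 + 2 * b))
    (hΦ₀ : 0 ≤ Φ₀) (hΦ : Φ₀ ≤ Φ) :
    3 / 200 * Φ₀ ^ 2 / Real.exp (4 * b) ≤ 2 * L / Q * ((δL - 3 * r) / 2 * (κ ^ 2 / (4 * b ^ 2)) * Φ ^ 2) := by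
  have hπ4 : π < 3.1416 := Real.pi_lt_d4
  have hb0 : 0 < b := by linarith
  have hL0 : 0 < L := by linarith
  set Eb := Real.exp b with hEb
  have hEb0 : 0 < Eb := Real.exp_pos b
  have hE2 : Real.exp (2 * b) = Eb ^ 2 := by rw [hEb, ← Real.exp_nat_mul]; ring_nf
  have hE4 : Real.exp (4 * b) = Eb ^ 4 := by rw [hEb, ← Real.exp_nat_mul]; ring_nf
  have hT17 : T ≤ 17.1 * Eb ^ 2 := by
    have e1 : Real.exp (1 + 2 * b) = Real.exp 1 * Eb ^ 2 := by rw [Real.exp_add, hE2]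
    rw [e1] at hTT₀
    have h2πe : 2 * π * Real.exp 1 ≤ 17.1 := by
      have he := Real.exp_one_lt_d9
      nlinarith only [hπ4, he, Real.exp_pos 1, Real.pi_pos]
    have := mul_le_mul_of_nonneg_right h2πe (pow_pos hEb0 2).le
    nlinarith only [this, hTT₀]
  -- `δL ≥ D = 0.124·b/Eb³`
  have hy0 : 0 ≤ y := by rw [hy]; positivity
  have hy2 : y ^ 2 = 4 * L ^ 3 := by rw [hy, mul_pow, mul_pow, Real.sq_sqrt hL0.le]; ring
  set D : ℝ := 0.124 * b / Eb ^ 3 with hD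
  have hD0 : 0 ≤ D := by positivity
  have hDδ : D ≤ δL := by
    have e : δL = Real.sqrt (y ^ 2 / pU) := by rw [hδL, Real.sqrt_div (sq_nonneg y), Real.sqrt_sq hy0]
    rw [e, Real.le_sqrt hD0 (by positivity), hD, div_pow, div_le_div_iff₀ (by positivity) hpU0, hy2]
    have hT3 : T ^ 3 ≤ (17.1 * Eb ^ 2) ^ 3 := pow_le_pow_left₀ hT0.le hT17 3
    have h1 : (0.124 * b) ^ 2 * pU ≤ (0.124 * b) ^ 2 * (41 / 100 * b * (17.1 * Eb ^ 2) ^ 3) := by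
      apply mul_le_mul_of_nonneg_left _ (by positivity); nlinarith only [hpU, hT3, hb0]
    have h2 : (2 * b) ^ 3 ≤ L ^ 3 := pow_le_pow_left₀ (by positivity) hL1 3
    have h3 : (0.124 * b) ^ 2 * (41 / 100 * b * (17.1 * Eb ^ 2) ^ 3) ≤ 4 * (2 * b) ^ 3 * (Eb ^ 3) ^ 2 := by
      have : 0 ≤ b ^ 3 * Eb ^ 6 := by positivity
      nlinarith only [this]
    have h4 : 4 * (2 * b) ^ 3 * (Eb ^ 3) ^ 2 ≤ 4 * L ^ 3 * (Eb ^ 3) ^ 2 := by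
      nlinarith only [h2, pow_pos hEb0 3]
    linarith only [h1, h3, h4]
  -- factor lower bounds
  have A1 : 4 * b / (1.011 * Eb) ≤ 2 * L / Q := by
    rw [div_le_div_iff₀ (by positivity) hQ0]
    have := mul_le_mul_of_nonneg_left hQ hb0.le
    nlinarith only [this, hL1, hEb0]
  have A2 : 199 / 400 * D ≤ (δL - 3 * r) / 2 := by linarith only [hDδ, hr, hD0]
  have A3 : 1 / (16 * b ^ 2) ≤ κ ^ 2 / (4 * b ^ 2) := by
    rw [div_le_div_iff₀ (by positivity) (by positivity)]
    have hκ2 : 1 / 4 ≤ κ ^ 2 := by nlinarith only [hκ]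
    nlinarith only [mul_le_mul_of_nonneg_right hκ2 (sq_nonneg b)]
  have A4 : Φ₀ ^ 2 ≤ Φ ^ 2 := pow_le_pow_left₀ hΦ₀ hΦ 2
  have B1 : 199 / 400 * D * (1 / (16 * b ^ 2)) ≤ (δL - 3 * r) / 2 * (κ ^ 2 / (4 * b ^ 2)) :=
    mul_le_mul A2 A3 (by positivity) (by linarith only [A2, hD0])
  have B2 : 199 / 400 * D * (1 / (16 * b ^ 2)) * Φ₀ ^ 2 ≤ (δL - 3 * r) / 2 * (κ ^ 2 / (4 * b ^ 2)) * Φ ^ 2 :=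
    mul_le_mul B1 A4 (by positivity) (mul_nonneg (by linarith only [A2, hD0]) (by positivity))
  have B3 : 4 * b / (1.011 * Eb) * (199 / 400 * D * (1 / (16 * b ^ 2)) * Φ₀ ^ 2) ≤
      2 * L / Q * ((δL - 3 * r) / 2 * (κ ^ 2 / (4 * b ^ 2)) * Φ ^ 2) :=
    mul_le_mul A1 B2 (by positivity) (by positivity)
  refine le_trans ?_ B3
  rw [hD, hE4]
  rw [show 4 * b / (1.011 * Eb) * (199 / 400 * (0.124 * b / Eb ^ 3) * (1 / (16 * b ^ 2)) * Φ₀ ^ 2)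
      = (4 * 199 * 0.124 / (1.011 * 400 * 16)) * (Φ₀ ^ 2 / Eb ^ 4) by field_simp]
  rw [mul_div_assoc]
  exact mul_le_mul_of_nonneg_right (by norm_num) (by positivity)

set_option maxHeartbeats 400000 in
/-- **The comparison (abstract form of `hlt`) for `b ≥ 11/2`**, given the profile-value inequality
`154000(b+1.84)e^{2b} < Φ₀²` for some `0 ≤ Φ₀ ≤ Φ`. [this track, ATTEMPT-21 §5] -/
theorem cost_lt_gain_small {T b k cI cL xL δU L Q δL r κ y pU Φ Φ₀ : ℝ} (hb : 11 / 2 ≤ b) (hL1 : 2 * b ≤ L)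
    (hTe : 17 * Real.exp (2 * b) ≤ T) (hTT₀ : T ≤ 2 * π * Real.exp (1 + 2 * b))
    (hk2 : 2 ≤ k) (hk : k ≤ 2 / 5 * b * T)
    (hcI : T ^ 3 / (19 * π) ≤ cI) (hcI2 : cI ≤ T ^ 3) (hcL : cL = 4 * cI) (hxL : xL = Real.sqrt (cL / 4))
    (hδ0 : 0 ≤ δU) (hδ1 : δU ≤ 1 / 1000)
    (hQ0 : 0 < Q) (hQ : Q ≤ 1.011 * Real.exp b) (hκ : 1 / 2 ≤ κ) (hr : 600 * r ≤ δL)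
    (hy : y = 2 * (L * Real.sqrt L)) (hδL : δL = y / Real.sqrt pU) (hpU0 : 0 < pU)
    (hpU : pU ≤ 41 / 100 * b * T ^ 3) (hΦ₀ : 0 ≤ Φ₀) (hΦ : Φ₀ ≤ Φ)
    (hval : 154000 * (b + 1.84) * Real.exp (2 * b) < Φ₀ ^ 2) :
    2 * (4 * (Real.sinh (δU / 2) ^ 2 + 1) * Real.exp 1 * (4 * Real.cosh (b / 2) ^ 2 * (1 + b) ^ 2 / b ^ 2)) *
        (((2 * T) / (2 * π) * Real.log ((2 * T) / (2 * π * Real.exp 1)) +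
              (0.1038 * Real.log (2 * T) + 0.2573 * Real.log (Real.log (2 * T)) + 9.3675)) / T ^ 2 *
            Real.exp (4 * (b / π * (1 + Real.log (k - 1))) - cL / (2 * T + 1) ^ 2) +
          Real.exp (144 * (2 * k) ^ 2 / (7 * cL)) * (Real.log xL / (Real.exp 1 * xL) + 220 * (Real.log xL + 1) / xL)) <
      2 * L / Q * ((δL - 3 * r) / 2 * (κ ^ 2 / (4 * b ^ 2)) * Φ ^ 2) := by
  have hT0 : 0 < T := by nlinarith [Real.exp_pos (2 * b)]
  have hC := cost_le_small hb hTe hTT₀ hk2 hk hcI hcI2 hcL hxL hδ0 hδ1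
  have hG := gain_ge_small hb hL1 hQ0 hQ hκ hr hy hδL hpU0 hpU hT0 hTT₀ hΦ₀ hΦ
  refine lt_of_le_of_lt hC (lt_of_lt_of_le ?_ hG)
  have hE := Real.exp_pos (2 * b)
  have hE4 : Real.exp (4 * b) = Real.exp (2 * b) * Real.exp (2 * b) := by rw [← Real.exp_add]; ring_nf
  rw [hE4, div_lt_div_iff₀ hE (by positivity)]
  have hpos : 0 < (b + 1.84) * Real.exp (2 * b) := by positivity
  nlinarith [mul_le_mul_of_nonneg_right hval.le hE.le, hval]

end Summit.RiemannHypothesis.RiemannHypothesis.Theorems.Handoff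

end
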